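import Summits.Schanuel.Schanuel.Theorems.RootDecomp1BHyperFrame02
import Summits.Schanuel.Schanuel.Theorems.RootDecomp1BRadicalDescent03

/-!
# RootDecomp1BHyperFrame — lens 4, generation 32 «HYPER-FRAME CELLS» (HyperFrame.lean f84fe52b…, 1151 l) — continuation (RootDecomp1BHyperFrame03): §E THE ENGINE `algebraicIndependent_cons_of_frameMeasure (hF : FrameMeasure y e) (hρ : HyperLiouville ρ)` (ρ adjoined, mixed exponents) + `engine_endgame`

(lens-4 g32 `HyperFrame.lean`, sha256 f84fe52b…46c4, own farm rc 0 · 0 sorry · axioms std; critic VERDICT STATUS L1693 PORT GO LOW; port by census-1 gen 15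
in five parts `RootDecomp1BHyperFrame01`–`05` — see the PORT NOTE of part 01 (tree binder `…RootDecomp1EPointTransfer.Roy2014_thm_1_1`); `--supports stmt-Schanuel-24622`; rung 0.)
-/

noncomputable section

open Complex IntermediateField MvPolynomial

namespace Summit.Schanuel.Schanuel.Theorems.RootDecomp1BHyperFrame

open Summit.Schanuel.Schanuel.Theorems.RootDecomp1EPointTransfer (Roy2014_thm_1_1)

open Summit.Schanuel.Schanuel.Theorems.RootDecomp1KHyper (mvlen mvlen_nonneg abs_coeff_le_mvlen one_le_mvlen
  exists_int_mul_eq_map mvaeval_int_map exists_ball_eval_ne_zero transcendental_ofReal_of_liouville)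
open Summit.Schanuel.Schanuel.Theorems.RootDecomp1KHyper.HyperCell (HyperLiouville lambdaH hyperLiouville_lambdaH)
open Summit.Schanuel.Schanuel.Theorems.RootDecomp1BFedFlagCore (KleinIH polarDeg polarField polarGens
  coe_mem_polarField coe_mul_I_mem_polarField exp_coe_mem_polarField exp_coe_mul_I_mem_polarField)
open Summit.Schanuel.Schanuel.Theorems.RootDecomp1BTameFlagCore (IsWild isAlgebraic_I)
open Summit.Schanuel.Schanuel.Theorems.RootDecomp1BDefectFloorDefs (SharpRelativeLindemannAt TameDefectZeroAt
  WildSharpDefectZeroAt WildSharpDefectZeroInitAt WildSharpInitAt)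
open Summit.Schanuel.Schanuel.Theorems.RootDecomp1BDefectFloorCells (polarDeg_le_two_mul_of_algebraic
  isAlgebraic_of_mem_span_algebraic natCast_le_trdeg_of_algebraicIndependent linearIndependent_polar
  isAlgebraic_polarExp)
open Summit.Schanuel.Schanuel.Theorems.RootDecomp1BSRLLogLiouville (sharp_init_snoc)

section Engine

variable {n : ℕ}

variable (P : MvPolynomial (Fin (n + 1)) ℤ) (y : Fin n → ℂ) (e : Fin n → ℕ)

-- PORT: `exists_int_relation` is the landed lens-4 g30 lemma (RootDecomp1BRadicalDescent03; gate dedup lint), the copy of this file is dropped.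
open Summit.Schanuel.Schanuel.Theorems.RootDecomp1BRadicalDescent (exists_int_relation)

/-- `exp(−x) < δ` once `x > δ⁻¹` (`δ > 0`). -/
private theorem exp_neg_lt_of_inv_lt_HF {δ x : ℝ} (hδ : 0 < δ) (hx : δ⁻¹ < x) : Real.exp (-x) < δ := by
  rw [Real.exp_neg, inv_lt_comm₀ (Real.exp_pos _) hδ]
  linarith [Real.add_one_le_exp x]

/-- `x^k ≤ exp (k x)` for `x ≥ 0`. -/
private theorem pow_le_exp_mul {x : ℝ} (hx : 0 ≤ x) (k : ℕ) : x ^ k ≤ Real.exp (k * x) := by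
  rw [Real.exp_nat_mul]
  exact pow_le_pow_left₀ hx (by linarith [Real.add_one_le_exp x]) k

/-- **THE ENGINE.**  A frame measure through `y` with exponents `e`, and a HYPER-Liouville `ρ`, make
`ρ, e^{ρ^{e₁} y₁}, …, e^{ρ^{eₙ} yₙ}` algebraically independent over ℚ. -/
theorem algebraicIndependent_cons_of_frameMeasure {y : Fin n → ℂ} {e : Fin n → ℕ}
    (hF : FrameMeasure y e) {ρ : ℝ} (hρ : HyperLiouville ρ) :
    AlgebraicIndependent ℚ
      (Fin.cons (ρ : ℂ) (fun j => cexp ((ρ : ℂ) ^ (e j) * y j)) : Fin (n + 1) → ℂ) := by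
  classical
  by_contra hdep
  obtain ⟨P, hP0, hPρ⟩ := exists_int_relation hdep
  have hFρ : Ff P y e ρ = 0 := by rw [Ff_eq_aeval]; exact hPρ
  obtain ⟨Kl, δ₁, hKl, hδ₁, hlip⟩ := exists_lipschitz_Ff P y e ρ
  -- the nonvanishing radius
  obtain ⟨s₀, hs₀⟩ := MvPolynomial.ne_zero_iff.mp hP0
  have hs₀' : s₀ ∈ P.support := MvPolynomial.mem_support_iff.mpr hs₀
  obtain ⟨g, hg⟩ : ∃ g : Polynomial ℂ, g = (gcoef P (Finsupp.tail s₀)).map (Int.castRingHom ℂ) :=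
    ⟨_, rfl⟩
  have hg0 : g ≠ 0 := by
    rw [hg]
    exact (Polynomial.map_ne_zero_iff (Int.castRingHom ℂ).injective_int).mpr (gcoef_ne_zero P hs₀')
  obtain ⟨δ, hδ, hball⟩ := exists_ball_eval_ne_zero g hg0 ρ
  -- the degree and the frame measure in that degree
  obtain ⟨d, hdP⟩ : ∃ d : ℕ, d = P.totalDegree := ⟨_, rfl⟩
  have hd : ∀ s ∈ P.support, s 0 ≤ d := fun s hs => hdP ▸ apply_zero_le_totalDegree P hs
  obtain ⟨C, N, hC, hFM⟩ := hF d
  -- the real constants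
  obtain ⟨L, hL⟩ : ∃ L : ℝ, L = ((mvlen P : ℤ) : ℝ) := ⟨_, rfl⟩
  have hL1 : 1 ≤ L := by rw [hL]; exact_mod_cast one_le_mvlen hP0
  have hlogL : 0 ≤ Real.log L := Real.log_nonneg hL1
  obtain ⟨R, hR⟩ : ∃ R : ℝ, R = |ρ| + 2 := ⟨_, rfl⟩
  have hR1 : 1 ≤ R := by rw [hR]; linarith [abs_nonneg ρ]
  have hR0 : 0 ≤ R := le_trans zero_le_one hR1
  have hd0 : (0 : ℝ) ≤ d := Nat.cast_nonneg _
  obtain ⟨Γ, hΓ⟩ : ∃ Γ : ℝ, Γ = C * Real.log L + C * d * R + C * R ^ N + d + Kl + 1 := ⟨_, rfl⟩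
  obtain ⟨k, hk⟩ : ∃ k : ℕ, Γ < 2 ^ k := pow_unbounded_of_one_lt Γ one_lt_two
  obtain ⟨m₁, hm₁⟩ : ∃ m₁ : ℕ, δ₁⁻¹ + δ⁻¹ + 1 < m₁ := exists_nat_gt _
  obtain ⟨m, hm⟩ : ∃ m : ℕ, m = N + 1 + k + m₁ + 2 := ⟨_, rfl⟩
  -- the approximant
  obtain ⟨r, hden, hne, hlt⟩ := hρ m
  have hb2 : 2 ≤ r.den := le_trans (by omega) hden
  have hb0 : r.den ≠ 0 := by omega
  have hb1R : (1 : ℝ) ≤ r.den := by exact_mod_cast le_trans one_le_two hb2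
  have hbposR : (0 : ℝ) < r.den := by positivity
  have hr0 : r ≠ 0 := by
    rintro rfl
    simp at hden
    omega
  have hrne : (r : ℝ) ≠ ρ := fun h => hne h.symm
  have hbm : (m₁ : ℝ) ≤ (r.den : ℝ) ^ m := by
    have h1 : (m₁ : ℝ) ≤ r.den := by exact_mod_cast le_trans (by omega) hden
    exact h1.trans (le_self_pow₀ hb1R (by omega))
  have hsmall : |ρ - r| < Real.exp (-(m₁ : ℝ)) :=
    hlt.trans_le (Real.exp_le_exp.mpr (neg_le_neg hbm))
  have hδinv : 0 < δ⁻¹ := inv_pos.mpr hδ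
  have hδ₁inv : 0 < δ₁⁻¹ := inv_pos.mpr hδ₁
  have hdist₁ : |(r : ℝ) - ρ| < δ₁ := by
    rw [abs_sub_comm]; exact hsmall.trans (exp_neg_lt_of_inv_lt_HF hδ₁ (by linarith))
  have hdist : |(r : ℝ) - ρ| < δ := by
    rw [abs_sub_comm]; exact hsmall.trans (exp_neg_lt_of_inv_lt_HF hδ (by linarith))
  have hdist1 : |ρ - r| < 1 :=
    hsmall.trans_le (Real.exp_le_one_iff.mpr (by simp))
  -- `|num r| ≤ (|ρ| + 1) den r`, so `T = |num r| + den r ≤ R · den r`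
  have hrabs : |(r : ℝ)| ≤ |ρ| + 1 := by
    have h := abs_sub_abs_le_abs_sub (r : ℝ) ρ
    rw [abs_sub_comm] at hdist1
    linarith
  have haR : ((|r.num| : ℤ) : ℝ) = |(r : ℝ)| * r.den := by
    rw [Int.cast_abs, Rat.cast_def, abs_div, Nat.abs_cast]
    field_simp
  obtain ⟨T, hT⟩ : ∃ T : ℝ, T = ((|r.num| : ℤ) : ℝ) + (r.den : ℝ) := ⟨_, rfl⟩
  have hTle : T ≤ R * r.den := by rw [hT, haR, hR]; nlinarith
  have hT1 : 1 ≤ T := by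
    have : (0 : ℝ) ≤ ((|r.num| : ℤ) : ℝ) := by exact_mod_cast abs_nonneg r.num
    rw [hT]; linarith
  have hT0 : 0 < T := lt_of_lt_of_le zero_lt_one hT1
  -- the specialised polynomial `Q`
  obtain ⟨Q, hQ⟩ : ∃ Q : MvPolynomial (Fin n) ℤ, Q = Qspec P r.num r.den d := ⟨_, rfl⟩
  have hab : ((r.num : ℂ) / (r.den : ℂ)) = ((r : ℝ) : ℂ) := by
    rw [Complex.ofReal_ratCast, Rat.cast_def]
  have hpt : (Fin.cons ((r.num : ℂ) / (r.den : ℂ)) (fun j => cexp ((((r : ℝ) : ℂ)) ^ (e j) * y j)) :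
      Fin (n + 1) → ℂ) = framePt y e (r : ℝ) := by
    rw [hab]; rfl
  have hQeval : aeval (fun j => cexp ((((r : ℝ) : ℂ)) ^ (e j) * y j)) Q =
      (r.den : ℂ) ^ d * Ff P y e r := by
    rw [hQ, aeval_Qspec P _ hb0 hd, hpt, Ff_eq_aeval]
  have hQ0 : Q ≠ 0 := by
    intro hQ0
    have h1 : (((Q.coeff (Finsupp.tail s₀)) : ℤ) : ℂ) = 0 := by
      rw [hQ0, MvPolynomial.coeff_zero, Int.cast_zero]
    rw [hQ, coeff_Qspec_eq P _ hb0 hd, hab, ← hg] at h1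
    rcases mul_eq_zero.mp h1 with h3 | h3
    · exact pow_ne_zero d (by exact_mod_cast hb0 : (r.den : ℂ) ≠ 0) h3
    · exact hball (r : ℝ) hrne hdist h3
  -- its height
  obtain ⟨Hz, hHz⟩ : ∃ Hz : ℤ, Hz = mvlen P * (|r.num| + (r.den : ℤ)) ^ d := ⟨_, rfl⟩
  have hHz1 : 1 ≤ Hz := by
    have h1 : (1 : ℤ) ≤ (|r.num| + (r.den : ℤ)) ^ d :=
      one_le_pow₀ (by
        have h2 := abs_nonneg r.num
        have h3 : (1 : ℤ) ≤ r.den := by exact_mod_cast r.den_pos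
        omega)
    rw [hHz]
    exact one_le_mul_of_one_le_of_one_le (one_le_mvlen hP0) h1
  obtain ⟨H, hH⟩ : ∃ H : ℕ, H = Hz.toNat := ⟨_, rfl⟩
  have hHZ : (H : ℤ) = Hz := by rw [hH]; exact Int.toNat_of_nonneg (by linarith)
  have hH1 : 1 ≤ H := by
    have h : (1 : ℤ) ≤ (H : ℤ) := by rw [hHZ]; exact hHz1
    exact_mod_cast h
  have hcoef : ∀ s, |Q.coeff s| ≤ (H : ℤ) := fun s => by
    rw [hHZ, hHz, hQ]; exact abs_coeff_Qspec_le P hd s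
  have hHR : (H : ℝ) = L * T ^ d := by
    have h1 : (H : ℝ) = ((Hz : ℤ) : ℝ) := by rw [← hHZ, Int.cast_natCast]
    rw [h1, hHz, hL, hT, Int.cast_mul, Int.cast_pow, Int.cast_add, Int.cast_natCast]
  -- THE FRAME MEASURE at `Q`
  have hlow := hFM r hr0 Q hQ0
    (by rw [hQ]; exact (totalDegree_Qspec_le P _ _ _).trans (le_of_eq hdP.symm)) H hH1 hcoef
  rw [← hT] at hlow
  have hlow' : Real.exp (-(C * (Real.log H + T ^ N))) ≤ (r.den : ℝ) ^ d * ‖Ff P y e r‖ := by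
    calc Real.exp (-(C * (Real.log H + T ^ N)))
        ≤ ‖aeval (fun j => cexp ((((r : ℝ) : ℂ)) ^ (e j) * y j)) Q‖ := hlow
      _ = (r.den : ℝ) ^ d * ‖Ff P y e r‖ := by
          rw [hQeval, norm_mul, norm_pow, Complex.norm_natCast]
  -- THE SMALLNESS of `F(r)`
  have hup : ‖Ff P y e r‖ ≤ Kl * Real.exp (-((r.den : ℝ) ^ m)) := by
    have h1 := hlip (r : ℝ) hdist₁
    rw [hFρ, sub_zero] at h1
    calc ‖Ff P y e r‖ ≤ Kl * |(r : ℝ) - ρ| := h1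
      _ ≤ Kl * Real.exp (-((r.den : ℝ) ^ m)) :=
          mul_le_mul_of_nonneg_left (by rw [abs_sub_comm]; exact hlt.le) hKl
  -- comparing the exponents
  have hlogH : Real.log H ≤ Real.log L + d * (R * r.den) := by
    rw [hHR, Real.log_mul (ne_of_gt (lt_of_lt_of_le zero_lt_one hL1)) (pow_ne_zero _ (ne_of_gt hT0)),
      Real.log_pow]
    have hlogT : Real.log T ≤ T := (Real.log_le_sub_one_of_pos hT0).trans (by linarith)
    have h2 : Real.log T ≤ R * r.den := hlogT.trans hTle
    nlinarith
  have hTN : T ^ N ≤ R ^ N * (r.den : ℝ) ^ N := by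
    rw [← mul_pow]; exact pow_le_pow_left₀ hT0.le hTle N
  have hexpo : C * (Real.log H + T ^ N) ≤
      C * Real.log L + C * d * R * r.den + C * R ^ N * (r.den : ℝ) ^ N := by
    have h : Real.log H + T ^ N ≤ Real.log L + d * (R * r.den) + R ^ N * (r.den : ℝ) ^ N :=
      add_le_add hlogH hTN
    calc C * (Real.log H + T ^ N) ≤ C * (Real.log L + d * (R * r.den) + R ^ N * (r.den : ℝ) ^ N) :=
        mul_le_mul_of_nonneg_left h hC
      _ = _ := by ring
  have hchain : Real.exp (-(C * Real.log L + C * d * R * r.den + C * R ^ N * (r.den : ℝ) ^ N)) ≤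
      Real.exp (d * r.den + Kl - (r.den : ℝ) ^ m) := by
    calc Real.exp (-(C * Real.log L + C * d * R * r.den + C * R ^ N * (r.den : ℝ) ^ N))
        ≤ Real.exp (-(C * (Real.log H + T ^ N))) := Real.exp_le_exp.mpr (neg_le_neg hexpo)
      _ ≤ (r.den : ℝ) ^ d * ‖Ff P y e r‖ := hlow'
      _ ≤ (r.den : ℝ) ^ d * (Kl * Real.exp (-((r.den : ℝ) ^ m))) :=
          mul_le_mul_of_nonneg_left hup (by positivity)
      _ ≤ Real.exp (d * r.den) * (Real.exp Kl * Real.exp (-((r.den : ℝ) ^ m))) :=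
          mul_le_mul (pow_le_exp_mul hbposR.le d)
            (mul_le_mul_of_nonneg_right (by linarith [Real.add_one_le_exp Kl]) (Real.exp_pos _).le)
            (by positivity) (by positivity)
      _ = Real.exp (d * r.den + Kl - (r.den : ℝ) ^ m) := by
          rw [← Real.exp_add, ← Real.exp_add]; congr 1; ring
  have hfinal : (r.den : ℝ) ^ m ≤
      C * Real.log L + C * d * R * r.den + C * R ^ N * (r.den : ℝ) ^ N + d * r.den + Kl := by
    have h := Real.exp_le_exp.mp hchain
    linarith
  exact absurd hfinal (not_le.mpr (engine_endgame hC hlogL hd0 hR0 hKl hΓ hk hb2 (by omega)))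

end Engine

end Summit.Schanuel.Schanuel.Theorems.RootDecomp1BHyperFrame

end
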